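import Mathlib.Analysis.Calculus.ContDiff.Basic
import Mathlib.Analysis.Calculus.ContDiff.Bounds
import Mathlib.Analysis.Calculus.ContDiff.Deriv
import Mathlib.Analysis.Calculus.FDeriv.CompCLM
import Mathlib.Analysis.Calculus.IteratedDeriv.Lemmas
import Mathlib.Analysis.Calculus.MeanValue
import Mathlib.Analysis.Normed.Group.Bounded
import Literature.Analysis.Distribution.TranslationQuasiInvariantFunctional
import HarnessLib

/-!
# Word derivatives of smooth functions: Leibniz rule, chain rules, iterated derivatives, and the
# Taylor flatness estimate transversal to a linear subspace

Topic `Analysis/Distribution`; namespace `Literature.Analysis.Distribution`. Calculus of the nested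
directional derivatives `∂_w f = ∂_{a₁} ⋯ ∂_{a_k} f` along words `w = [a₁, …, a_k]`
(`vecWordDeriv` of `TranslationQuasiInvariantFunctional`) needed for the analysis of distributions
supported on a linear subspace `{0} × Z ⊂ B × Z` (Hörmander, Thm. 2.3.3; Schwartz's structure of
distributions carried by a submanifold):

* §1 linearity in the direction, chain rule under continuous linear maps (`vecWordDeriv_comp_clm`),
  smoothness of word derivatives (`ContDiff.vecWordDeriv'`);
* §2 **`vecWordDeriv_eq_iteratedFDeriv`** — `∂_w f (x) = D^{|w|} f(x)(w₁, …, w_k)` for smooth `f`, whence the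
  bound `‖∂_w f(x)‖ ≤ ‖D^{|w|} f (x)‖ ∏ ‖wᵢ‖` and invariance under permutations of the word;
* §3 the **Leibniz rule** `∂_w (f g) = Σ_{(u,v)} ∂_u f · ∂_v g` over the `2^{|w|}` ordered splittings
  `wordPairs w` of the word;
* §4 **flatness transversal to `{0} × Z`**: `NormalJetsVanishBelow j g` (all normal word derivatives of
  order `< j` vanish on `{0} × Z`) is inherited, with the loss of `|u|` orders, by `∂_u g` for ANY word `u`
  (tangential letters are commuted to the front, where they differentiate a function vanishing on the
  subspace);
* §5 the **Taylor flatness estimate** `‖g(b, z)‖ ≤ A ‖b‖^{m+1}` for a test function with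
  `NormalJetsVanishBelow (m+1) g` (Taylor's theorem along the ray `s ↦ g(s b/‖b‖, z)` with the uniform bound
  `sup ‖D^{m+1} g‖`).

Everything is proved; no definition of mathematical content beyond the bookkeeping ones and no named fact
is introduced.

## References

* L. Hörmander, *The Analysis of Linear Partial Differential Operators I* (1983), Thm. 2.3.3 and
  (1.1.7)–(1.1.9) (Taylor's formula) [HormanderALPDO1].
-/

noncomputable section

open Set Filter Topology Function
open scoped ContDiff

namespace Literature.Analysis.Distribution

variable {X : Type*} [NormedAddCommGroup X] [NormedSpace ℝ X]

/-! ### 1. Linearity in the direction, chain rules, smoothness -/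

section Basic

/-- `∂_{u+v} f = ∂_u f + ∂_v f`. [folklore] -/
theorem vecDeriv_add_dir (u v : X) (f : X → ℂ) : vecDeriv (u + v) f = vecDeriv u f + vecDeriv v f := by
  funext x; simp [vecDeriv, map_add]

/-- `∂_{c u} f = c ∂_u f` for real `c`. [folklore] -/
theorem vecDeriv_smul_dir (c : ℝ) (u : X) (f : X → ℂ) : vecDeriv (c • u) f = (c : ℂ) • vecDeriv u f := by
  funext x; simp [vecDeriv, map_smul, Complex.real_smul]

/-- `∂_0 f = 0`. [folklore] -/
@[simp] theorem vecDeriv_zero_dir (f : X → ℂ) : vecDeriv (0 : X) f = 0 := by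
  funext x; simp [vecDeriv]

/-- `∂_w` along a word containing the scaled letters `c • a`: `∂_{c • w} f = c^{|w|} ∂_w f`. [folklore] -/
theorem vecWordDeriv_map_smul (c : ℝ) (f : X → ℂ) :
    ∀ w : List X, vecWordDeriv (w.map fun a => c • a) f = ((c : ℂ) ^ w.length) • vecWordDeriv w f
  | [] => by simp
  | a :: w => by
    rw [List.map_cons, vecWordDeriv_cons, vecWordDeriv_map_smul c f w, vecDeriv_smul_dir, vecDeriv_smul,
      vecWordDeriv_cons, smul_smul, List.length_cons, pow_succ']

/-- Smooth functions have smooth directional derivatives. [folklore] -/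
theorem _root_.ContDiff.vecDeriv' {f : X → ℂ} (hf : ContDiff ℝ ∞ f) (v : X) : ContDiff ℝ ∞ (vecDeriv v f) := by
  have h1 : ContDiff ℝ ∞ (fderiv ℝ f) := hf.fderiv_right (m := ∞) (by simp)
  exact h1.clm_apply contDiff_const

/-- Smooth functions have smooth word derivatives. [folklore] -/
theorem _root_.ContDiff.vecWordDeriv' {f : X → ℂ} (hf : ContDiff ℝ ∞ f) :
    ∀ w : List X, ContDiff ℝ ∞ (vecWordDeriv w f)
  | [] => hf
  | a :: w => (ContDiff.vecWordDeriv' hf w).vecDeriv' a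

/-- `∂_w (f + g) = ∂_w f + ∂_w g` for smooth `f, g`. [folklore] -/
theorem vecWordDeriv_add' {f g : X → ℂ} (hf : ContDiff ℝ ∞ f) (hg : ContDiff ℝ ∞ g) :
    ∀ w : List X, vecWordDeriv w (f + g) = vecWordDeriv w f + vecWordDeriv w g
  | [] => rfl
  | a :: w => by
    rw [vecWordDeriv_cons, vecWordDeriv_add' hf hg w, vecWordDeriv_cons, vecWordDeriv_cons]
    exact vecDeriv_add ((hf.vecWordDeriv' w).differentiable (by simp)) ((hg.vecWordDeriv' w).differentiable (by simp)) a

/-- `∂_w (∂_v f) = ∂_v (∂_w f)` for smooth `f`. [folklore] -/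
theorem vecWordDeriv_vecDeriv' {f : X → ℂ} (hf : ContDiff ℝ ∞ f) (v : X) :
    ∀ w : List X, vecWordDeriv w (vecDeriv v f) = vecDeriv v (vecWordDeriv w f)
  | [] => rfl
  | a :: w => by
    rw [vecWordDeriv_cons, vecWordDeriv_vecDeriv' hf v w, vecWordDeriv_cons]
    exact vecDeriv_comm (hf.vecWordDeriv' w) a v

/-- **Chain rule under a continuous linear map**: `∂_u (φ ∘ A)(x) = (∂_{A u} φ)(A x)`. [folklore] -/
theorem vecDeriv_comp_clm {Y : Type*} [NormedAddCommGroup Y] [NormedSpace ℝ Y] (A : X →L[ℝ] Y)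
    {φ : Y → ℂ} (hφ : Differentiable ℝ φ) (u : X) :
    vecDeriv u (fun x => φ (A x)) = fun x => vecDeriv (A u) φ (A x) := by
  funext x
  simp only [vecDeriv]
  rw [show (fun x => φ (A x)) = φ ∘ A from rfl, fderiv_comp x (hφ (A x)) A.differentiableAt, A.fderiv]
  rfl

/-- Word version of the chain rule: `∂_w (φ ∘ A) = (∂_{A w} φ) ∘ A`. [folklore] -/
theorem vecWordDeriv_comp_clm {Y : Type*} [NormedAddCommGroup Y] [NormedSpace ℝ Y] (A : X →L[ℝ] Y)
    {φ : Y → ℂ} (hφ : ContDiff ℝ ∞ φ) :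
    ∀ w : List X, vecWordDeriv w (fun x => φ (A x)) = fun x => vecWordDeriv (w.map A) φ (A x)
  | [] => rfl
  | a :: w => by
    rw [vecWordDeriv_cons, vecWordDeriv_comp_clm A hφ w, List.map_cons, vecWordDeriv_cons]
    exact vecDeriv_comp_clm A ((hφ.vecWordDeriv' (w.map A)).differentiable (by simp)) a

/-- Word derivatives commute with translations `x ↦ x + p`. [folklore] -/
theorem vecWordDeriv_comp_add_right (f : X → ℂ) (p : X) (w : List X) :
    vecWordDeriv w (fun x => f (x + p)) = fun x => vecWordDeriv w f (x + p) := by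
  have h := vecWordDeriv_translate (-p) f w
  have hfun : (fun x => f (x + p)) = translate (-p) f := by
    funext x; simp [translate, sub_neg_eq_add]
  rw [hfun, h]
  funext x
  simp [translate, sub_neg_eq_add]

/-- **The flow derivative along a line**: `s ↦ F(x + s v)` has derivative `(∂_v F)(x + s v)`. [folklore] -/
theorem hasDerivAt_add_smul_line {F : X → ℂ} (hF : Differentiable ℝ F) (x v : X) (s : ℝ) :
    HasDerivAt (fun s : ℝ => F (x + s • v)) (vecDeriv v F (x + s • v)) s := by
  have hγ : HasDerivAt (fun s : ℝ => x + s • v) v s := by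
    simpa using ((hasDerivAt_id s).smul_const v).const_add x
  have h := (hF (x + s • v)).hasFDerivAt.comp_hasDerivAt s hγ
  exact h

end Basic

/-! ### 2. Word derivatives are iterated Fréchet derivatives -/

section Iterated

/-- **`∂_w f (x) = D^{|w|} f (x) (w₁, …, w_k)`** for smooth `f` (`iteratedFDeriv_succ_apply_left`: the
outermost letter is differentiated last). [folklore] -/
theorem vecWordDeriv_eq_iteratedFDeriv {f : X → ℂ} (hf : ContDiff ℝ ∞ f) :
    ∀ (w : List X) (x : X), vecWordDeriv w f x = iteratedFDeriv ℝ w.length f x fun i => w.get i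
  | [], x => by simp
  | a :: w, x => by
    have hfun : vecWordDeriv w f = fun y => iteratedFDeriv ℝ w.length f y fun i => w.get i :=
      funext (vecWordDeriv_eq_iteratedFDeriv hf w)
    have hdiff : DifferentiableAt ℝ (iteratedFDeriv ℝ w.length f) x :=
      (hf.differentiable_iteratedFDeriv (m := w.length) (mod_cast ENat.coe_lt_top w.length)) x
    have htuple : (fun i : Fin (w.length + 1) => (a :: w).get i) = Fin.cons a fun i => w.get i := by
      funext i; refine Fin.cases ?_ (fun j => ?_) i <;> simp
    calc vecWordDeriv (a :: w) f x = fderiv ℝ (vecWordDeriv w f) x a := rfl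
      _ = (fderiv ℝ (iteratedFDeriv ℝ w.length f) x) a (fun i => w.get i) := by
          rw [hfun, fderiv_continuousMultilinear_apply_const_apply hdiff]
      _ = iteratedFDeriv ℝ (w.length + 1) f x (Fin.cons a fun i => w.get i) := by
          rw [iteratedFDeriv_succ_apply_left, Fin.cons_zero, Fin.tail_cons]
      _ = iteratedFDeriv ℝ (a :: w).length f x (fun i => (a :: w).get i) := by
          rw [← htuple]; rfl

/-- **`‖∂_w f (x)‖ ≤ ‖D^{|w|} f(x)‖ ∏ᵢ ‖wᵢ‖`.** [folklore] -/
theorem norm_vecWordDeriv_le {f : X → ℂ} (hf : ContDiff ℝ ∞ f) (w : List X) (x : X) :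
    ‖vecWordDeriv w f x‖ ≤ ‖iteratedFDeriv ℝ w.length f x‖ * ∏ i, ‖w.get i‖ := by
  rw [vecWordDeriv_eq_iteratedFDeriv hf w x]
  exact ContinuousMultilinearMap.le_opNorm _ _

/-- A word of letters of norm `≤ 1`: `‖∂_w f(x)‖ ≤ ‖D^{|w|} f (x)‖`. [folklore] -/
theorem norm_vecWordDeriv_le_of_norm_le_one {f : X → ℂ} (hf : ContDiff ℝ ∞ f) {w : List X}
    (hw : ∀ a ∈ w, ‖a‖ ≤ 1) (x : X) : ‖vecWordDeriv w f x‖ ≤ ‖iteratedFDeriv ℝ w.length f x‖ := by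
  refine (norm_vecWordDeriv_le hf w x).trans ?_
  have hprod : ∏ i, ‖w.get i‖ ≤ 1 := by
    refine Finset.prod_le_one (fun i _ => norm_nonneg _) fun i _ => hw _ (List.get_mem w i)
  calc ‖iteratedFDeriv ℝ w.length f x‖ * ∏ i, ‖w.get i‖ ≤ ‖iteratedFDeriv ℝ w.length f x‖ * 1 :=
        mul_le_mul_of_nonneg_left hprod (norm_nonneg _)
    _ = _ := mul_one _

/-- A test function has uniformly bounded iterated derivatives of each order. [folklore] -/
theorem IsTestFn.exists_bound_iteratedFDeriv {f : X → ℂ} (hf : IsTestFn f) (i : ℕ) :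
    ∃ A : ℝ, 0 ≤ A ∧ ∀ x, ‖iteratedFDeriv ℝ i f x‖ ≤ A := by
  obtain ⟨C, hC⟩ := (hf.hasCompactSupport.iteratedFDeriv i).exists_bound_of_continuous
    (hf.contDiff.continuous_iteratedFDeriv (mod_cast le_top))
  exact ⟨max C 0, le_max_right _ _, fun x => (hC x).trans (le_max_left _ _)⟩

/-- Word derivatives of a smooth function do not depend on the order of the letters. [folklore] -/
theorem vecWordDeriv_perm {f : X → ℂ} (hf : ContDiff ℝ ∞ f) {w w' : List X} (h : w.Perm w') :
    vecWordDeriv w f = vecWordDeriv w' f := by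
  induction h with
  | nil => rfl
  | cons a _ ih => rw [vecWordDeriv_cons, vecWordDeriv_cons, ih]
  | swap a b w =>
    rw [vecWordDeriv_cons, vecWordDeriv_cons, vecWordDeriv_cons, vecWordDeriv_cons]
    exact vecDeriv_comm (hf.vecWordDeriv' w) b a
  | trans _ _ ih₁ ih₂ => exact ih₁.trans ih₂

end Iterated

/-! ### 3. The Leibniz rule over splittings of a word -/

section Leibniz

omit [NormedAddCommGroup X] [NormedSpace ℝ X] in
/-- **The ordered splittings of a word** into two complementary sub-words (`2^{|w|}` of them):
`wordPairs (a :: w)` prepends `a` either to the first or to the second component of each splitting of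
`w`. [folklore] -/
def wordPairs : List X → List (List X × List X)
  | [] => [([], [])]
  | a :: w => (wordPairs w).map (fun p => (a :: p.1, p.2)) ++ (wordPairs w).map fun p => (p.1, a :: p.2)

omit [NormedAddCommGroup X] [NormedSpace ℝ X] in
/-- `wordPairs [] = [([], [])]`. [folklore] -/
@[simp] theorem wordPairs_nil : wordPairs ([] : List X) = [([], [])] := rfl

omit [NormedAddCommGroup X] [NormedSpace ℝ X] in
/-- The recursion of `wordPairs`. [folklore] -/
theorem wordPairs_cons (a : X) (w : List X) :
    wordPairs (a :: w) = (wordPairs w).map (fun p => (a :: p.1, p.2)) ++ (wordPairs w).map fun p => (p.1, a :: p.2) :=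
  rfl

omit [NormedAddCommGroup X] [NormedSpace ℝ X] in
/-- The two components of a splitting have complementary lengths. [folklore] -/
theorem length_add_length_of_mem_wordPairs :
    ∀ {w : List X} {p : List X × List X}, p ∈ wordPairs w → p.1.length + p.2.length = w.length
  | [], p, hp => by
    rw [wordPairs_nil, List.mem_singleton] at hp
    subst hp; rfl
  | a :: w, p, hp => by
    rw [wordPairs_cons, List.mem_append, List.mem_map, List.mem_map] at hp
    rcases hp with ⟨q, hq, rfl⟩ | ⟨q, hq, rfl⟩
    · have h := length_add_length_of_mem_wordPairs hq
      simp only [List.length_cons]; omega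
    · have h := length_add_length_of_mem_wordPairs hq
      simp only [List.length_cons]; omega

/-- `∂_v (f g) = ∂_v f · g + f · ∂_v g`. [folklore] -/
theorem vecDeriv_mul {f g : X → ℂ} (hf : Differentiable ℝ f) (hg : Differentiable ℝ g) (v : X) :
    vecDeriv v (f * g) = vecDeriv v f * g + f * vecDeriv v g := by
  funext x
  simp only [vecDeriv, Pi.add_apply, Pi.mul_apply]
  rw [fderiv_mul (hf x) (hg x)]
  simp only [FunLike.coe_add, FunLike.coe_smul, Pi.add_apply, Pi.smul_apply, smul_eq_mul]
  ring

/-- `∂_v` of a finite sum of differentiable functions. [folklore] -/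
theorem differentiable_sum_and_vecDeriv_sum (v : X) :
    ∀ L : List (X → ℂ), (∀ F ∈ L, Differentiable ℝ F) →
      Differentiable ℝ L.sum ∧ vecDeriv v L.sum = (L.map (vecDeriv v)).sum
  | [], _ => by
    refine ⟨?_, ?_⟩
    · rw [List.sum_nil]; exact differentiable_const (0 : ℂ)
    · rw [List.sum_nil, List.map_nil, List.sum_nil]; funext x; simp [vecDeriv]
  | F :: L, hL => by
    obtain ⟨hd, hv⟩ := differentiable_sum_and_vecDeriv_sum v L fun G hG => hL G (List.mem_cons_of_mem _ hG)
    have hF : Differentiable ℝ F := hL F List.mem_cons_self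
    refine ⟨?_, ?_⟩
    · rw [List.sum_cons]; exact hF.add hd
    · rw [List.sum_cons, List.map_cons, List.sum_cons, vecDeriv_add hF hd, hv]

/-- **Leibniz rule for word derivatives**: `∂_w (f g) = Σ_{(u,v) ∈ wordPairs w} ∂_u f · ∂_v g` for smooth
`f, g`. [folklore] -/
theorem vecWordDeriv_mul {f g : X → ℂ} (hf : ContDiff ℝ ∞ f) (hg : ContDiff ℝ ∞ g) :
    ∀ w : List X, vecWordDeriv w (f * g) = ((wordPairs w).map fun p => vecWordDeriv p.1 f * vecWordDeriv p.2 g).sum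
  | [] => by simp
  | a :: w => by
    rw [vecWordDeriv_cons, vecWordDeriv_mul hf hg w]
    have hdiff : ∀ F ∈ (wordPairs w).map (fun p => vecWordDeriv p.1 f * vecWordDeriv p.2 g), Differentiable ℝ F := by
      intro F hF
      rw [List.mem_map] at hF
      obtain ⟨p, _, rfl⟩ := hF
      exact ((hf.vecWordDeriv' p.1).differentiable (by simp)).mul ((hg.vecWordDeriv' p.2).differentiable (by simp))
    rw [(differentiable_sum_and_vecDeriv_sum a _ hdiff).2, List.map_map, wordPairs_cons, List.map_append,
      List.sum_append, List.map_map, List.map_map]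
    have hterm : ∀ p : List X × List X,
        ((vecDeriv a) ∘ fun p : List X × List X => vecWordDeriv p.1 f * vecWordDeriv p.2 g) p =
          ((fun p : List X × List X => vecWordDeriv p.1 f * vecWordDeriv p.2 g) ∘ fun p => (a :: p.1, p.2)) p +
          ((fun p : List X × List X => vecWordDeriv p.1 f * vecWordDeriv p.2 g) ∘ fun p => (p.1, a :: p.2)) p := by
      intro p
      simp only [Function.comp_apply, vecWordDeriv_cons]
      exact vecDeriv_mul ((hf.vecWordDeriv' p.1).differentiable (by simp))
        ((hg.vecWordDeriv' p.2).differentiable (by simp)) a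
    rw [List.map_congr_left (fun p _ => hterm p), List.sum_map_add]

end Leibniz

/-! ### 4. Flatness transversal to the subspace `{0} × Z` -/

section Flat

variable {B Z : Type*} [NormedAddCommGroup B] [NormedSpace ℝ B] [NormedAddCommGroup Z] [NormedSpace ℝ Z]

omit [NormedAddCommGroup B] [NormedSpace ℝ B] [NormedSpace ℝ Z] in
/-- The normal word of a list of letters of `B`: the letters `(b, 0)` of `B × Z`. [folklore] -/
def normalWord (w : List B) : List (B × Z) := w.map fun b => ((b, 0) : B × Z)

omit [NormedAddCommGroup B] [NormedSpace ℝ B] [NormedSpace ℝ Z] in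
/-- `normalWord [] = []`. [folklore] -/
@[simp] theorem normalWord_nil : normalWord (Z := Z) ([] : List B) = [] := rfl

omit [NormedAddCommGroup B] [NormedSpace ℝ B] [NormedSpace ℝ Z] in
/-- `normalWord (b :: w) = (b, 0) :: normalWord w`. [folklore] -/
@[simp] theorem normalWord_cons (b : B) (w : List B) : normalWord (Z := Z) (b :: w) = ((b, 0) : B × Z) :: normalWord w := rfl

omit [NormedAddCommGroup B] [NormedSpace ℝ B] [NormedSpace ℝ Z] in
/-- `normalWord (w ++ w') = normalWord w ++ normalWord w'`. [folklore] -/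
theorem normalWord_append (w w' : List B) : normalWord (Z := Z) (w ++ w') = normalWord w ++ normalWord w' :=
  List.map_append

omit [NormedAddCommGroup B] [NormedSpace ℝ B] [NormedSpace ℝ Z] in
/-- `|normalWord w| = |w|`. [folklore] -/
@[simp] theorem length_normalWord (w : List B) : (normalWord (Z := Z) w).length = w.length := List.length_map _

omit [NormedAddCommGroup B] [NormedSpace ℝ B] [NormedSpace ℝ Z] in
/-- `normalWord (replicate i b) = replicate i (b, 0)`. [folklore] -/
theorem normalWord_replicate (i : ℕ) (b : B) : normalWord (Z := Z) (List.replicate i b) = List.replicate i ((b, 0) : B × Z) :=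
  List.map_replicate

/-- **All normal jets of order `< j` vanish on the subspace `{0} × Z`**: `∂_w g (0, z) = 0` for every normal
word `w` of length `< j`. [folklore] -/
def NormalJetsVanishBelow (j : ℕ) (g : B × Z → ℂ) : Prop :=
  ∀ w : List B, w.length < j → ∀ z : Z, vecWordDeriv (normalWord w) g (0, z) = 0

/-- No condition below order `0`. [folklore] -/
theorem normalJetsVanishBelow_zero (g : B × Z → ℂ) : NormalJetsVanishBelow 0 g := fun _ hw => absurd hw (Nat.not_lt_zero _)

/-- Monotonicity in the order. [folklore] -/
theorem NormalJetsVanishBelow.mono {j j' : ℕ} {g : B × Z → ℂ} (h : NormalJetsVanishBelow j g) (hj : j' ≤ j) :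
    NormalJetsVanishBelow j' g := fun w hw z => h w (lt_of_lt_of_le hw hj) z

/-- A function with vanishing `0`-jet vanishes on the subspace. [folklore] -/
theorem NormalJetsVanishBelow.apply_zero {j : ℕ} {g : B × Z → ℂ} (h : NormalJetsVanishBelow j g) (hj : 0 < j) (z : Z) :
    g (0, z) = 0 := by
  simpa using h [] (by simpa using hj) z

/-- `NormalJetsVanishBelow` is preserved by sums. [folklore] -/
theorem NormalJetsVanishBelow.add {j : ℕ} {f g : B × Z → ℂ} (hfs : ContDiff ℝ ∞ f) (hgs : ContDiff ℝ ∞ g)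
    (hf : NormalJetsVanishBelow j f) (hg : NormalJetsVanishBelow j g) : NormalJetsVanishBelow j (f + g) := by
  intro w hw z
  rw [vecWordDeriv_add' hfs hgs, Pi.add_apply, hf w hw z, hg w hw z, add_zero]

/-- `NormalJetsVanishBelow` is preserved by scalar multiples. [folklore] -/
theorem NormalJetsVanishBelow.smul {j : ℕ} {g : B × Z → ℂ} (hg : NormalJetsVanishBelow j g) (c : ℂ) :
    NormalJetsVanishBelow j (c • g) := by
  intro w hw z
  rw [vecWordDeriv_smul, Pi.smul_apply, hg w hw z, smul_zero]

/-- A tangential derivative of a function vanishing on `{0} × Z` vanishes on `{0} × Z`. [folklore] -/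
theorem vecDeriv_inr_eq_zero_of_forall_eq_zero {G : B × Z → ℂ} (hG : Differentiable ℝ G) (h0 : ∀ z, G (0, z) = 0)
    (ζ z : Z) : vecDeriv ((0 : B), ζ) G (0, z) = 0 := by
  have h1 := hasDerivAt_add_smul_line hG ((0 : B), z) ((0 : B), ζ) 0
  have h2 : (fun s : ℝ => G (((0 : B), z) + s • ((0 : B), ζ))) = fun _ => 0 := by
    funext s
    simp only [Prod.smul_mk, smul_zero, Prod.mk_add_mk, add_zero, h0]
  rw [h2, zero_smul, add_zero] at h1
  exact h1.unique (hasDerivAt_const (0 : ℝ) (0 : ℂ))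

/-- **Flatness survives one derivative, in any direction, with the loss of one order.** [folklore] -/
theorem NormalJetsVanishBelow.vecDeriv {j : ℕ} {g : B × Z → ℂ} (hgs : ContDiff ℝ ∞ g) (hg : NormalJetsVanishBelow j g)
    (a : B × Z) : NormalJetsVanishBelow (j - 1) (Distribution.vecDeriv a g) := by
  intro w hw z
  have hsplit : a = ((a.1, 0) : B × Z) + ((0 : B), a.2) := by ext <;> simp
  rw [hsplit, vecDeriv_add_dir, vecWordDeriv_add' (hgs.vecDeriv' _) (hgs.vecDeriv' _), Pi.add_apply]
  have h1 : Distribution.vecWordDeriv (normalWord w) (Distribution.vecDeriv ((a.1, 0) : B × Z) g) (0, z) = 0 := by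
    rw [← vecWordDeriv_append_singleton, show normalWord w ++ [((a.1, 0) : B × Z)] = normalWord (w ++ [a.1]) by
      rw [normalWord_append]; rfl]
    exact hg _ (by simp; omega) z
  have h2 : Distribution.vecWordDeriv (normalWord w) (Distribution.vecDeriv ((0 : B), a.2) g) (0, z) = 0 := by
    rw [vecWordDeriv_vecDeriv' hgs]
    exact vecDeriv_inr_eq_zero_of_forall_eq_zero ((hgs.vecWordDeriv' _).differentiable (by simp))
      (fun z' => hg w (by omega) z') a.2 z
  rw [h1, h2, add_zero]

/-- **Flatness survives a word of derivatives with the loss of `|u|` orders.** [folklore] -/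
theorem NormalJetsVanishBelow.vecWordDeriv {j : ℕ} {g : B × Z → ℂ} (hgs : ContDiff ℝ ∞ g) (hg : NormalJetsVanishBelow j g) :
    ∀ u : List (B × Z), NormalJetsVanishBelow (j - u.length) (vecWordDeriv u g)
  | [] => by simpa using hg
  | a :: u => by
    rw [vecWordDeriv_cons, List.length_cons, show j - (u.length + 1) = (j - u.length) - 1 by omega]
    exact (NormalJetsVanishBelow.vecWordDeriv hgs hg u).vecDeriv (hgs.vecWordDeriv' u) a

end Flat

/-! ### 5. The Taylor flatness estimate -/

section Taylor

/-- **Flat Taylor estimate on `[0, t]`**: if `φ^{(i)}(0) = 0` for `i ≤ m` and `‖φ^{(m+1)}‖ ≤ M` on `[0, t]`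
then `‖φ(t)‖ ≤ M t^{m+1}` (iterated mean value inequality). [cite: HormanderALPDO1, (1.1.7)] -/
theorem norm_le_of_iteratedDeriv_eq_zero :
    ∀ (m : ℕ) {φ : ℝ → ℂ}, ContDiff ℝ ∞ φ → (∀ i ≤ m, iteratedDeriv i φ 0 = 0) →
      ∀ {M t : ℝ}, 0 ≤ t → (∀ u ∈ Icc (0 : ℝ) t, ‖iteratedDeriv (m + 1) φ u‖ ≤ M) → ‖φ t‖ ≤ M * t ^ (m + 1)
  | 0, φ, hφ, h0, M, t, ht, hM => by
    have hd : Differentiable ℝ φ := hφ.differentiable (by simp)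
    have hφ0 : φ 0 = 0 := by simpa using h0 0 le_rfl
    have key := norm_image_sub_le_of_norm_deriv_le_segment' (f := φ) (f' := deriv φ) (a := 0) (b := t)
      (fun x _ => (hd x).hasDerivAt.hasDerivWithinAt)
      (fun x hx => by simpa [iteratedDeriv_one] using hM x (Ico_subset_Icc_self hx)) t (right_mem_Icc.2 ht)
    simpa [hφ0] using key
  | m + 1, φ, hφ, h0, M, t, ht, hM => by
    have hd : Differentiable ℝ φ := hφ.differentiable (by simp)
    have hφ0 : φ 0 = 0 := by simpa using h0 0 (Nat.zero_le _)
    have hderiv : ContDiff ℝ ∞ (deriv φ) := hφ.iterate_deriv 1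
    -- the derivative is flat of order `m` and its `(m+1)`-st derivative is the `(m+2)`-nd of `φ`
    have hflat' : ∀ i ≤ m, iteratedDeriv i (deriv φ) 0 = 0 := fun i hi => by
      rw [← iteratedDeriv_succ']; exact h0 (i + 1) (by omega)
    have hbound' : ∀ u ∈ Icc (0 : ℝ) t, ‖deriv φ u‖ ≤ M * t ^ (m + 1) := by
      intro u hu
      have hu0 : 0 ≤ u := hu.1
      have h1 : ‖deriv φ u‖ ≤ M * u ^ (m + 1) :=
        norm_le_of_iteratedDeriv_eq_zero m hderiv hflat' hu0 fun u' hu' => by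
          rw [← iteratedDeriv_succ']
          exact hM u' ⟨hu'.1, hu'.2.trans hu.2⟩
      have hMnn : 0 ≤ M := by
        have := hM 0 (left_mem_Icc.2 ht)
        exact (norm_nonneg _).trans this
      exact h1.trans (mul_le_mul_of_nonneg_left (pow_le_pow_left₀ hu0 hu.2 _) hMnn)
    have key := norm_image_sub_le_of_norm_deriv_le_segment' (f := φ) (f' := deriv φ) (a := 0) (b := t)
      (fun x _ => (hd x).hasDerivAt.hasDerivWithinAt)
      (fun x hx => hbound' x (Ico_subset_Icc_self hx)) t (right_mem_Icc.2 ht)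
    rw [hφ0, sub_zero, sub_zero] at key
    calc ‖φ t‖ ≤ M * t ^ (m + 1) * t := key
      _ = M * t ^ (m + 1 + 1) := by ring

variable {B Z : Type*} [NormedAddCommGroup B] [NormedSpace ℝ B] [NormedAddCommGroup Z] [NormedSpace ℝ Z]

/-- **Derivatives along a ray are word derivatives along a repeated letter**:
`(d/ds)^i g(x + s v) = ∂_{[v, …, v]} g (x + s v)`. [folklore] -/
theorem iteratedDeriv_comp_line {g : X → ℂ} (hg : ContDiff ℝ ∞ g) (v : X) :
    ∀ (i : ℕ) (x : X) (s : ℝ),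
      iteratedDeriv i (fun s : ℝ => g (x + s • v)) s = vecWordDeriv (List.replicate i v) g (x + s • v)
  | 0, x, s => by simp
  | i + 1, x, s => by
    rw [iteratedDeriv_succ']
    have hd : deriv (fun s : ℝ => g (x + s • v)) = fun s : ℝ => vecDeriv v g (x + s • v) := by
      funext r
      exact (hasDerivAt_add_smul_line (hg.differentiable (by simp)) x v r).deriv
    rw [hd, iteratedDeriv_comp_line (hg.vecDeriv' v) v i x s, ← vecWordDeriv_append_singleton,
      List.replicate_succ']

/-- **The Taylor flatness estimate transversal to `{0} × Z`**: a test function `g` on `B × Z` all of whose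
normal jets of order `≤ m` vanish on `{0} × Z` satisfies `‖g(b, z)‖ ≤ A ‖b‖^{m+1}` with
`A = sup ‖D^{m+1} g‖` (Taylor's formula along the ray from `(0, z)` to `(b, z)`).
[cite: HormanderALPDO1, Thm. 2.3.3 (proof)] -/
theorem exists_norm_le_pow_of_normalJetsVanishBelow {g : B × Z → ℂ} (hg : IsTestFn g) {m : ℕ}
    (hflat : NormalJetsVanishBelow (m + 1) g) :
    ∃ A : ℝ, 0 ≤ A ∧ ∀ (b : B) (z : Z), ‖g (b, z)‖ ≤ A * ‖b‖ ^ (m + 1) := by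
  obtain ⟨A, hA0, hA⟩ := hg.exists_bound_iteratedFDeriv (m + 1)
  refine ⟨A, hA0, fun b z => ?_⟩
  by_cases hb : b = 0
  · subst hb
    rw [hflat.apply_zero (Nat.succ_pos m) z, norm_zero, norm_zero, zero_pow (Nat.succ_ne_zero m), mul_zero]
  · -- the unit vector of the ray and the one-variable restriction
    set e : B := ‖b‖⁻¹ • b with he
    have hbpos : 0 < ‖b‖ := norm_pos_iff.2 hb
    have hnorme : ‖e‖ = 1 := by
      rw [he, norm_smul, norm_inv, norm_norm, inv_mul_cancel₀ hbpos.ne']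
    have hnormv : ‖((e, 0) : B × Z)‖ ≤ 1 := by
      rw [Prod.norm_mk, norm_zero, hnorme, max_eq_left zero_le_one]
    set φ : ℝ → ℂ := fun s => g (((0 : B), z) + s • ((e, 0) : B × Z)) with hφ
    have hφs : ContDiff ℝ ∞ φ :=
      hg.contDiff.comp ((contDiff_const).add (contDiff_id.smul contDiff_const))
    have hφval : φ ‖b‖ = g (b, z) := by
      simp only [hφ, he, Prod.smul_mk, smul_smul, mul_inv_cancel₀ hbpos.ne', one_smul, smul_zero, Prod.mk_add_mk,
        zero_add, add_zero]
    have hderiv : ∀ (i : ℕ) (s : ℝ), iteratedDeriv i φ s =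
        vecWordDeriv (normalWord (List.replicate i e)) g (((0 : B), z) + s • ((e, 0) : B × Z)) := fun i s => by
      rw [normalWord_replicate]
      exact iteratedDeriv_comp_line hg.contDiff _ i _ s
    have hflatφ : ∀ i ≤ m, iteratedDeriv i φ 0 = 0 := fun i hi => by
      rw [hderiv, zero_smul, add_zero]
      exact hflat _ (by simpa using Nat.lt_succ_of_le hi) z
    have hboundφ : ∀ u ∈ Icc (0 : ℝ) ‖b‖, ‖iteratedDeriv (m + 1) φ u‖ ≤ A := fun u _ => by
      rw [hderiv]
      refine (norm_vecWordDeriv_le_of_norm_le_one hg.contDiff (fun a ha => ?_) _).trans ?_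
      · rw [normalWord_replicate] at ha
        rw [List.eq_of_mem_replicate ha]
        exact hnormv
      · have hlen : (normalWord (Z := Z) (List.replicate (m + 1) e)).length = m + 1 := by simp
        rw [hlen]; exact hA _
    have key := norm_le_of_iteratedDeriv_eq_zero m hφs hflatφ hbpos.le hboundφ
    rwa [hφval] at key

end Taylor

end Literature.Analysis.Distribution
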